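import Mathlib
import HarnessLib
import Literature.Probability.LatticeModels.GibbsSpecificationProofs
import Literature.Probability.LatticeModels.CriticalGibbsUniqueness
import Literature.Probability.LatticeModels.IsingConfigSums

/-!
# Punctured boxes: conditioning a finite-volume Ising measure on one spin
(route BallSpecification, support item stmt-CriticalPhenomena-5730 `LatticePuncturedUniqueness`,
helper file 1/3)

Finite-volume facts for the Ising model on a locally finite graph `G` with countable vertex set:

* `isingMeasure_fixed_inter_apply_eq` — a site `z ∉ Λ` is frozen by the boundary condition:
  `μ^η_Λ(A ∩ {σ_z = s}) = 1{η_z = s} μ^η_Λ(A)` (properness);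
* `isingMeasure_fixed_inter_apply_eq_mul` — **conditioning identity**: for `z ∈ Λ'`,
  `μ^η_{Λ'}(A ∩ {σ_z = s}) = μ^{η[z ↦ s]}_{Λ' ∖ {z}}(A) · μ^η_{Λ'}(σ_z = s)`, i.e. the measure of the
  punctured volume `Λ' ∖ {z}` with the spin `s` frozen at `z` is the `Λ'`-measure conditioned on
  `{σ_z = s}` (consistency of the Ising specification, Friedli–Velenik 2017, Lemma 6.7);
* the probabilities of `{σ_z = s}` and `{σ_i = 1} ∩ {σ_z = s}` as spin expectations, and the
  resulting formula / bound for the *punctured single-site gap*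
  `μ^{+,s}_{Λ'∖z}(σ_i = 1) − μ^{−,s}_{Λ'∖z}(σ_i = 1) = (m_i − c·m_z)/(1 − m_z²)` at `h = 0`
  (`m_x = ⟨σ_x⟩⁺_{Λ'}`, `c = ⟨σ_iσ_z⟩⁺_{Λ'}`), which tends to `0` along any volumes on which the plus
  magnetisations tend to `0`.

References: S. Friedli, Y. Velenik, *Statistical Mechanics of Lattice Systems* (CUP 2017), §3.1,
Lemma 6.7, §3.7.1 (spin flip); H.-O. Georgii, *Gibbs Measures and Phase Transitions* (2011),
Def. 1.23. No definitions, no named facts.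
-/

namespace Summit.CriticalPhenomena.Ising3DConformalLimit.Theorems.LatticePunctured

open MeasureTheory Filter Topology Finset
open scoped ENNReal
open Literature.Probability.LatticeModels

variable {V : Type*} (G : SimpleGraph V) [DecidableEq V] [G.LocallyFinite]

/-! ### Single-site cylinders -/

omit [DecidableEq V] in
/-- `1{σ_z = s} = (1 + s̃ σ_z)/2` with `s̃ = s ∈ {±1} ⊆ ℝ` (Friedli–Velenik 2017, §3.6.2,
`n_i = (1 + σ_i)/2`). [cite: FriedliVelenik2017, §3.6.2, p. 107] -/
theorem indicator_apply_eq (z : V) (s : ℤˣ) :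
    ({σ : SpinConfig V | σ z = s}).indicator (1 : SpinConfig V → ℝ) =
      fun σ => (1 + ((s : ℤ) : ℝ) * spinAt z σ) / 2 := by
  -- `s̃ * s̃ = 1` for a sign `s ∈ {±1}`
  have hss : ((s : ℤ) : ℝ) * ((s : ℤ) : ℝ) = 1 := by
    rcases Int.units_eq_one_or s with rfl | rfl <;> simp
  funext σ
  by_cases hσ : σ z = s
  · rw [Set.indicator_of_mem (show σ ∈ {σ : SpinConfig V | σ z = s} from hσ)]
    simp only [Pi.one_apply, spinAt, hσ, hss]
    norm_num
  · rw [Set.indicator_of_notMem (show σ ∉ {σ : SpinConfig V | σ z = s} from hσ)]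
    have hσ' : σ z = -s := by
      rcases Int.units_eq_one_or s with rfl | rfl <;>
        rcases Int.units_eq_one_or (σ z) with h | h <;> simp_all
    simp only [spinAt, hσ', Units.val_neg, Int.cast_neg, mul_neg, hss]
    norm_num

omit [DecidableEq V] in
/-- For a probability measure, `ρ(σ_z = s) = (1 + s̃ ∫ σ_z dρ)/2`
(Friedli–Velenik 2017, §3.6.2). [cite: FriedliVelenik2017, §3.6.2, p. 107] -/
theorem measureReal_apply_eq (ρ : Measure (SpinConfig V)) [IsProbabilityMeasure ρ] (z : V) (s : ℤˣ) :
    ρ.real {σ : SpinConfig V | σ z = s} = (1 + ((s : ℤ) : ℝ) * ∫ σ, spinAt z σ ∂ρ) / 2 := by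
  have hint : Integrable (spinAt z) ρ :=
    Integrable.of_bound (measurable_spinAt z).aestronglyMeasurable 1
      (Eventually.of_forall fun σ => by rw [Real.norm_eq_abs, abs_spinAt])
  rw [← integral_indicator_one (measurableSet_apply_eq z s), indicator_apply_eq, integral_div,
    integral_add (integrable_const 1) (hint.const_mul _), integral_const, smul_eq_mul, mul_one,
    probReal_univ, integral_const_mul]

omit [DecidableEq V] in
/-- For a probability measure,
`ρ(σ_i = 1, σ_z = s) = (1 + ∫σ_i + s̃ ∫σ_z + s̃ ∫σ_iσ_z)/4` (product of the indicators
`(1 + σ_i)/2` and `(1 + s̃σ_z)/2`) (Friedli–Velenik 2017, §3.6.2). [cite: FriedliVelenik2017, §3.6.2, p. 107] -/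
theorem measureReal_eq_one_inter_apply_eq (ρ : Measure (SpinConfig V)) [IsProbabilityMeasure ρ]
    (i z : V) (s : ℤˣ) :
    ρ.real ({σ : SpinConfig V | σ i = 1} ∩ {σ : SpinConfig V | σ z = s}) =
      (1 + ∫ σ, spinAt i σ ∂ρ + ((s : ℤ) : ℝ) * ∫ σ, spinAt z σ ∂ρ +
        ((s : ℤ) : ℝ) * ∫ σ, spinAt i σ * spinAt z σ ∂ρ) / 4 := by
  have hbound : ∀ (f : SpinConfig V → ℝ), Measurable f → (∀ σ, |f σ| ≤ 1) → Integrable f ρ :=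
    fun f hf hb => Integrable.of_bound hf.aestronglyMeasurable 1
      (Eventually.of_forall fun σ => by rw [Real.norm_eq_abs]; exact hb σ)
  have hi : Integrable (spinAt i) ρ := hbound _ (measurable_spinAt i) fun σ => (abs_spinAt i σ).le
  have hz : Integrable (spinAt z) ρ := hbound _ (measurable_spinAt z) fun σ => (abs_spinAt z σ).le
  have hiz : Integrable (fun σ => spinAt i σ * spinAt z σ) ρ :=
    hbound _ ((measurable_spinAt i).mul (measurable_spinAt z)) fun σ => by
      rw [abs_mul, abs_spinAt, abs_spinAt, mul_one]
  have hind : ({σ : SpinConfig V | σ i = 1} ∩ {σ : SpinConfig V | σ z = s}).indicator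
      (1 : SpinConfig V → ℝ) = fun σ => (1 + spinAt i σ + ((s : ℤ) : ℝ) * spinAt z σ +
        ((s : ℤ) : ℝ) * (spinAt i σ * spinAt z σ)) / 4 := by
    have h1 := indicator_apply_eq (V := V) i 1
    have h2 := indicator_apply_eq (V := V) z s
    rw [Set.inter_indicator_one, h1, h2]
    funext σ
    simp only [Pi.mul_apply, Units.val_one, Int.cast_one, one_mul]
    ring
  rw [← integral_indicator_one ((measurableSet_eq_one i).inter (measurableSet_apply_eq z s)), hind,
    integral_div, integral_add, integral_add, integral_add (integrable_const 1) hi, integral_const,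
    smul_eq_mul, mul_one, probReal_univ, integral_const_mul, integral_const_mul]
  · exact (integrable_const 1).add hi
  · exact hz.const_mul _
  · exact ((integrable_const 1).add hi).add (hz.const_mul _)
  · exact hiz.const_mul _

/-! ### Freezing a site: properness and the conditioning identity -/

/-- **A site outside the volume is frozen by the boundary condition** (properness of the Ising
kernels, Georgii 2011, Def. 1.23 (ii); Friedli–Velenik 2017, §6.2): for `z ∉ Λ`,
`μ^η_{Λ;β,h}(A ∩ {σ_z = s}) = μ^η_{Λ;β,h}(A)` if `η_z = s` and `= 0` otherwise. [cite: Georgii2011, Def. 1.23] -/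
theorem isingMeasure_fixed_inter_apply_eq [Countable V] (Λ : Finset V) {z : V} (hz : z ∉ Λ)
    (β h : ℝ) (η : SpinConfig V) (s : ℤˣ) (A : Set (SpinConfig V)) :
    isingMeasure G Λ β h (.fixed η) (A ∩ {σ : SpinConfig V | σ z = s}) =
      if η z = s then isingMeasure G Λ β h (.fixed η) A else 0 := by
  have hae := ae_eqOn_compl_isingMeasure_fixed G Λ β h η
  split_ifs with hη
  · refine measure_inter_conull (mem_ae_iff.1 ?_)
    filter_upwards [hae] with σ hσ
    exact (hσ z hz).trans hη
  · refine measure_inter_null_of_null_right A (measure_eq_zero_iff_ae_notMem.2 ?_)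
    filter_upwards [hae] with σ hσ
    show ¬ (σ z = s)
    rw [hσ z hz]
    exact hη

/-- **Conditioning identity** (consistency of the Ising specification, Friedli–Velenik 2017,
Lemma 6.7, with properness, Georgii 2011, Def. 1.23): for `z ∈ Λ'` and measurable `A`,
`μ^η_{Λ'}(A ∩ {σ_z = s}) = μ^{η[z ↦ s]}_{Λ' ∖ {z}}(A) · μ^η_{Λ'}(σ_z = s)` — the finite-volume measure
of the punctured volume with the spin `s` frozen at `z` is the `Λ'`-measure conditioned on
`σ_z = s`. [cite: FriedliVelenik2017, Lemma 6.7] -/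
theorem isingMeasure_fixed_inter_apply_eq_mul [Countable V] (Λ' : Finset V) {z : V} (hz : z ∈ Λ')
    (β h : ℝ) (η : SpinConfig V) (s : ℤˣ) {A : Set (SpinConfig V)} (hA : MeasurableSet A) :
    isingMeasure G Λ' β h (.fixed η) (A ∩ {σ : SpinConfig V | σ z = s}) =
      isingMeasure G (Λ'.erase z) β h (.fixed (Function.update η z s)) A *
        isingMeasure G Λ' β h (.fixed η) {σ : SpinConfig V | σ z = s} := by
  have hS := measurableSet_apply_eq (V := V) z s
  have hz' : z ∉ Λ'.erase z := Finset.notMem_erase z Λ'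
  rw [← lintegral_isingMeasure_fixed_consistent G (Finset.erase_subset z Λ') β h η (hA.inter hS)]
  simp_rw [isingMeasure_fixed_inter_apply_eq G (Λ'.erase z) hz' β h _ s A]
  set c := isingMeasure G (Λ'.erase z) β h (.fixed (Function.update η z s)) A with hc
  have hcongr : ∀ᵐ σ ∂(isingMeasure G Λ' β h (.fixed η)),
      (if σ z = s then isingMeasure G (Λ'.erase z) β h (.fixed σ) A else 0) =
        ({σ : SpinConfig V | σ z = s}).indicator (fun _ => c) σ := by
    filter_upwards [ae_eqOn_compl_isingMeasure_fixed G Λ' β h η] with σ hσ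
    by_cases hzs : σ z = s
    · rw [if_pos hzs, Set.indicator_of_mem (show σ ∈ {σ : SpinConfig V | σ z = s} from hzs), hc]
      refine isingMeasure_fixed_congr_of_eqOn_compl G _ β h (fun x hx => ?_) hA
      by_cases hxz : x = z
      · subst hxz
        rw [Function.update_self, hzs]
      · rw [Function.update_of_ne hxz]
        exact hσ x fun hx' => hx (Finset.mem_erase.2 ⟨hxz, hx'⟩)
    · rw [if_neg hzs, Set.indicator_of_notMem (show σ ∉ {σ : SpinConfig V | σ z = s} from hzs)]
  rw [lintegral_congr_ae hcongr, lintegral_indicator_const hS]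

/-- The finite-volume measure charges every single-site cylinder of a site of the volume:
`μ^{bc}_{Λ'}(σ_z = s) ≠ 0` for `z ∈ Λ'` (all Boltzmann weights are positive,
Friedli–Velenik 2017, §3.1). [cite: FriedliVelenik2017, §3.1  Def. 3.1] -/
theorem isingMeasure_apply_eq_ne_zero (Λ' : Finset V) {z : V} (hz : z ∈ Λ') (β h : ℝ)
    (bc : BoundaryCondition V) (s : ℤˣ) :
    isingMeasure G Λ' β h bc {σ : SpinConfig V | σ z = s} ≠ 0 := by
  classical
  have hmem : glue Λ' (fun _ => s) bc ∈ {σ : SpinConfig V | σ z = s} := by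
    show glue Λ' (fun _ => s) bc z = s
    rw [glue_apply_of_mem _ _ _ hz]
  intro h0
  have h1 : isingMeasure G Λ' β h bc {glue Λ' (fun _ => s) bc} = 0 :=
    measure_mono_null (Set.singleton_subset_iff.2 hmem) h0
  rw [isingMeasure_apply_singleton_holds G Λ' β h bc] at h1
  have hpos : 0 < isingWeight G Λ' β h bc (fun _ => s) / isingPartitionFunction G Λ' β h bc :=
    div_pos (isingWeight_pos G Λ' β h bc _) (isingPartitionFunction_pos G Λ' β h bc)
  exact (not_le.2 hpos) (ENNReal.ofReal_eq_zero.1 h1)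

/-- Real form: `μ^{bc}_{Λ'}(σ_z = s) > 0` for `z ∈ Λ'`. [cite: FriedliVelenik2017, §3.1  Def. 3.1] -/
theorem measureReal_apply_eq_pos (Λ' : Finset V) {z : V} (hz : z ∈ Λ') (β h : ℝ)
    (bc : BoundaryCondition V) (s : ℤˣ) :
    0 < (isingMeasure G Λ' β h bc).real {σ : SpinConfig V | σ z = s} :=
  (ENNReal.toReal_pos (isingMeasure_apply_eq_ne_zero G Λ' hz β h bc s) (measure_ne_top _ _))

/-- **Conditioning identity, real quotient form**: for `z ∈ Λ'`,
`μ^{η[z ↦ s]}_{Λ'∖{z}}(A) = μ^η_{Λ'}(A ∩ {σ_z = s}) / μ^η_{Λ'}(σ_z = s)`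
(Friedli–Velenik 2017, Lemma 6.7). [cite: FriedliVelenik2017, Lemma 6.7] -/
theorem measureReal_erase_update_eq_div [Countable V] (Λ' : Finset V) {z : V} (hz : z ∈ Λ')
    (β h : ℝ) (η : SpinConfig V) (s : ℤˣ) {A : Set (SpinConfig V)} (hA : MeasurableSet A) :
    (isingMeasure G (Λ'.erase z) β h (.fixed (Function.update η z s))).real A =
      (isingMeasure G Λ' β h (.fixed η)).real (A ∩ {σ : SpinConfig V | σ z = s}) /
        (isingMeasure G Λ' β h (.fixed η)).real {σ : SpinConfig V | σ z = s} := by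
  have hpos := measureReal_apply_eq_pos G Λ' hz β h (.fixed η) s
  rw [eq_div_iff hpos.ne', measureReal_def, measureReal_def, measureReal_def,
    isingMeasure_fixed_inter_apply_eq_mul G Λ' hz β h η s hA, ENNReal.toReal_mul]

/-! ### The punctured single-site gap at `h = 0` -/

/-- `∫ σ_i σ_z dρ = ⟨σ_{{i,z}}⟩_ρ` for `i ≠ z` (Friedli–Velenik 2017, §3.6.1). [cite: FriedliVelenik2017, §3.6.1] -/
theorem integral_spinAt_mul_spinAt (ρ : Measure (SpinConfig V)) {i z : V} (hiz : i ≠ z) :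
    ∫ σ, spinAt i σ * spinAt z σ ∂ρ = spinCorr ρ {i, z} := by
  rw [spinCorr]
  refine integral_congr_ae (Eventually.of_forall fun σ => ?_)
  simp [spinProduct, Finset.prod_pair hiz]

/-- **Spin flip at `h = 0` for pairs**: `⟨σ_iσ_z⟩⁻_{Λ;β,0} = ⟨σ_iσ_z⟩⁺_{Λ;β,0}` (`|{i,z}|` even)
(Friedli–Velenik 2017, §3.7.1). [cite: FriedliVelenik2017, §3.7.1 and Exercise 3.4] -/
theorem isingCorr_minus_pair_eq (Λ : Finset V) (β : ℝ) {i z : V} (hiz : i ≠ z) :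
    isingCorr G Λ β 0 .minus {i, z} = isingCorr G Λ β 0 .plus {i, z} := by
  have hflip := isingCorr_fixed_flip_holds G Λ β 0 1 {i, z}
  rw [neg_zero, Finset.card_pair hiz] at hflip
  change isingCorr G Λ β 0 (.fixed (-1)) {i, z} = isingCorr G Λ β 0 (.fixed 1) {i, z}
  rw [hflip]
  norm_num

/-- **The punctured single-site gap at `h = 0`** (conditioning identity + spin flip,
Friedli–Velenik 2017, Lemma 6.7 and §3.7.1): for `z ∈ Λ'`, `i ≠ z` and `s ∈ {±1}`,
`μ^{+[z↦s]}_{Λ'∖z}(σ_i = 1) − μ^{−[z↦s]}_{Λ'∖z}(σ_i = 1) = (m_i − c·m_z)/(1 − m_z²)` with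
`m_x = ⟨σ_x⟩⁺_{Λ'}`, `c = ⟨σ_iσ_z⟩⁺_{Λ'}`; in particular it does not depend on `s`. [cite: FriedliVelenik2017, Lemma 6.7] -/
theorem puncturedGap_eq [Countable V] (Λ' : Finset V) {z i : V} (hz : z ∈ Λ') (hiz : i ≠ z)
    (β : ℝ) (s : ℤˣ) :
    (isingMeasure G (Λ'.erase z) β 0 (.fixed (Function.update 1 z s))).real
        {σ : SpinConfig V | σ i = 1} -
      (isingMeasure G (Λ'.erase z) β 0 (.fixed (Function.update (-1) z s))).real
        {σ : SpinConfig V | σ i = 1} =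
      (isingExpect G Λ' β 0 .plus (spinAt i) -
          isingCorr G Λ' β 0 .plus {i, z} * isingExpect G Λ' β 0 .plus (spinAt z)) /
        (1 - isingExpect G Λ' β 0 .plus (spinAt z) ^ 2) := by
  have hA : MeasurableSet {σ : SpinConfig V | σ i = 1} := measurableSet_eq_one i
  -- the two punctured measures as conditioned `Λ'`-measures
  rw [measureReal_erase_update_eq_div G Λ' hz β 0 1 s hA,
    measureReal_erase_update_eq_div G Λ' hz β 0 (-1) s hA]
  -- positivity of the conditioning events
  have hP := measureReal_apply_eq_pos G Λ' hz β 0 (.fixed 1) s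
  have hM := measureReal_apply_eq_pos G Λ' hz β 0 (.fixed (-1)) s
  rw [measureReal_apply_eq] at hP hM
  rw [measureReal_eq_one_inter_apply_eq, measureReal_eq_one_inter_apply_eq,
    measureReal_apply_eq, measureReal_apply_eq,
    integral_spinAt_mul_spinAt (isingMeasure G Λ' β 0 (.fixed 1)) hiz,
    integral_spinAt_mul_spinAt (isingMeasure G Λ' β 0 (.fixed (-1))) hiz]
  -- everything in terms of plus expectations (spin flip at `h = 0`)
  have e1 : ∫ σ, spinAt i σ ∂isingMeasure G Λ' β 0 (.fixed 1) =
      isingExpect G Λ' β 0 .plus (spinAt i) := rfl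
  have e2 : ∫ σ, spinAt z σ ∂isingMeasure G Λ' β 0 (.fixed 1) =
      isingExpect G Λ' β 0 .plus (spinAt z) := rfl
  have e3 : spinCorr (isingMeasure G Λ' β 0 (.fixed 1)) {i, z} = isingCorr G Λ' β 0 .plus {i, z} :=
    rfl
  have e4 : ∫ σ, spinAt i σ ∂isingMeasure G Λ' β 0 (.fixed (-1)) =
      -isingExpect G Λ' β 0 .plus (spinAt i) := isingExpect_minus_spinAt_eq_neg G Λ' β i
  have e5 : ∫ σ, spinAt z σ ∂isingMeasure G Λ' β 0 (.fixed (-1)) =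
      -isingExpect G Λ' β 0 .plus (spinAt z) := isingExpect_minus_spinAt_eq_neg G Λ' β z
  have e6 : spinCorr (isingMeasure G Λ' β 0 (.fixed (-1))) {i, z} =
      isingCorr G Λ' β 0 .plus {i, z} := isingCorr_minus_pair_eq G Λ' β hiz
  rw [e2] at hP
  rw [e5] at hM
  rw [e1, e2, e3, e4, e5, e6]
  set a := isingExpect G Λ' β 0 .plus (spinAt i)
  set b := isingExpect G Λ' β 0 .plus (spinAt z)
  set c := isingCorr G Λ' β 0 .plus {i, z}
  rcases Int.units_eq_one_or s with rfl | rfl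
  · simp only [Units.val_one, Int.cast_one, one_mul] at hP hM ⊢
    have h1 : (0 : ℝ) < 1 + b := by linarith
    have h2 : (0 : ℝ) < 1 - b := by linarith
    have h3 : 1 - b ^ 2 ≠ 0 := by
      rw [show 1 - b ^ 2 = (1 + b) * (1 - b) by ring]; exact mul_ne_zero h1.ne' h2.ne'
    have h1' := h1.ne'
    have h2' : 1 + -b ≠ 0 := by rw [← sub_eq_add_neg]; exact h2.ne'
    have h2'' := h2.ne'
    field_simp
    ring
  · simp only [Units.val_neg, Units.val_one, Int.cast_neg, Int.cast_one, neg_mul, one_mul,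
      mul_neg, neg_neg] at hP hM ⊢
    have h1 : (0 : ℝ) < 1 - b := by linarith
    have h2 : (0 : ℝ) < 1 + b := by linarith
    have h3 : 1 - b ^ 2 ≠ 0 := by
      rw [show 1 - b ^ 2 = (1 + b) * (1 - b) by ring]; exact mul_ne_zero h2.ne' h1.ne'
    have h1' : 1 + -b ≠ 0 := by rw [← sub_eq_add_neg]; exact h1.ne'
    have h2' := h2.ne'
    field_simp
    ring

/-- `1 − ⟨σ_z⟩⁺² > 0` in finite volume for `z ∈ Λ'` at `h = 0`: both `{σ_z = ±1}` have positive
`μ⁺_{Λ'}`-probability `(1 ± ⟨σ_z⟩⁺)/2`. [cite: FriedliVelenik2017, §3.6.2, p. 107] -/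
theorem one_sub_sq_isingExpect_pos (Λ' : Finset V) {z : V} (hz : z ∈ Λ') (β : ℝ) :
    0 < 1 - isingExpect G Λ' β 0 .plus (spinAt z) ^ 2 := by
  have hP := measureReal_apply_eq_pos G Λ' hz β 0 .plus 1
  have hM := measureReal_apply_eq_pos G Λ' hz β 0 .plus (-1)
  rw [measureReal_apply_eq] at hP hM
  simp only [Units.val_one, Int.cast_one, one_mul, Units.val_neg, Int.cast_neg, neg_mul] at hP hM
  change 0 < (1 + isingExpect G Λ' β 0 .plus (spinAt z)) / 2 at hP
  change 0 < (1 + -isingExpect G Λ' β 0 .plus (spinAt z)) / 2 at hM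
  nlinarith

/-- **Bound on the punctured single-site gap**: for `z ∈ Λ'`, `i ≠ z`,
`|μ^{+[z↦s]}_{Λ'∖z}(σ_i = 1) − μ^{−[z↦s]}_{Λ'∖z}(σ_i = 1)| ≤ (|⟨σ_i⟩⁺_{Λ'}| + |⟨σ_z⟩⁺_{Λ'}|)/(1 − ⟨σ_z⟩⁺_{Λ'}²)`
(from `puncturedGap_eq` and `|⟨σ_iσ_z⟩| ≤ 1`). [cite: FriedliVelenik2017, Lemma 6.7] -/
theorem abs_puncturedGap_le [Countable V] (Λ' : Finset V) {z i : V} (hz : z ∈ Λ') (hiz : i ≠ z)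
    (β : ℝ) (s : ℤˣ) :
    |(isingMeasure G (Λ'.erase z) β 0 (.fixed (Function.update 1 z s))).real
          {σ : SpinConfig V | σ i = 1} -
        (isingMeasure G (Λ'.erase z) β 0 (.fixed (Function.update (-1) z s))).real
          {σ : SpinConfig V | σ i = 1}| ≤
      (|isingExpect G Λ' β 0 .plus (spinAt i)| + |isingExpect G Λ' β 0 .plus (spinAt z)|) /
        (1 - isingExpect G Λ' β 0 .plus (spinAt z) ^ 2) := by
  rw [puncturedGap_eq G Λ' hz hiz β s]
  have hD := one_sub_sq_isingExpect_pos G Λ' hz β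
  have hc : |isingCorr G Λ' β 0 .plus {i, z}| ≤ 1 := abs_isingCorr_le_one G Λ' β 0 .plus {i, z}
  rw [abs_div, abs_of_pos hD]
  refine div_le_div_of_nonneg_right ?_ hD.le
  calc |isingExpect G Λ' β 0 .plus (spinAt i) -
          isingCorr G Λ' β 0 .plus {i, z} * isingExpect G Λ' β 0 .plus (spinAt z)|
        ≤ |isingExpect G Λ' β 0 .plus (spinAt i)| +
            |isingCorr G Λ' β 0 .plus {i, z} * isingExpect G Λ' β 0 .plus (spinAt z)| :=
          abs_sub _ _
    _ ≤ |isingExpect G Λ' β 0 .plus (spinAt i)| + |isingExpect G Λ' β 0 .plus (spinAt z)| := by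
          rw [abs_mul]
          gcongr
          exact mul_le_of_le_one_left (abs_nonneg _) hc

/-- **The punctured single-site gap vanishes along volumes on which the plus magnetisations do**
(`ℤ^d`, boxes punctured at the origin): if `⟨σ_x⟩⁺_{B(L);β,0} → 0` for every `x`, then for
`i ≠ 0` and `s ∈ {±1}`,
`μ^{+[0↦s]}_{B(L)∖0}(σ_i = 1) − μ^{−[0↦s]}_{B(L)∖0}(σ_i = 1) → 0` as `L → ∞`. [cite: FriedliVelenik2017, Lemma 6.7 and Thm. 3.28] -/
theorem tendsto_puncturedGap {d : ℕ} {β : ℝ} {i : Site d} (hi : i ≠ 0) (s : ℤˣ)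
    (hmag : ∀ x : Site d,
      Tendsto (fun L : ℕ => isingExpect (zdGraph d) (box d L) β 0 .plus (spinAt x)) atTop (𝓝 0)) :
    Tendsto (fun L : ℕ =>
      (isingMeasure (zdGraph d) ((box d L).erase 0) β 0 (.fixed (Function.update 1 0 s))).real
          {σ : SpinConfig (Site d) | σ i = 1} -
        (isingMeasure (zdGraph d) ((box d L).erase 0) β 0 (.fixed (Function.update (-1) 0 s))).real
          {σ : SpinConfig (Site d) | σ i = 1}) atTop (𝓝 0) := by
  have ha : Tendsto (fun L : ℕ => (|isingExpect (zdGraph d) (box d L) β 0 .plus (spinAt i)| +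
      |isingExpect (zdGraph d) (box d L) β 0 .plus (spinAt 0)|) /
        (1 - isingExpect (zdGraph d) (box d L) β 0 .plus (spinAt 0) ^ 2)) atTop
      (𝓝 ((|0| + |0|) / (1 - 0 ^ 2))) :=
    (((hmag i).abs).add ((hmag 0).abs)).div (tendsto_const_nhds.sub ((hmag 0).pow 2)) (by norm_num)
  rw [show ((|0| + |0|) / (1 - 0 ^ 2) : ℝ) = 0 by norm_num] at ha
  refine squeeze_zero_norm (fun L => ?_) ha
  rw [Real.norm_eq_abs]
  exact abs_puncturedGap_le (zdGraph d) (box d L) (zero_mem_box d L) hi β s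

end Summit.CriticalPhenomena.Ising3DConformalLimit.Theorems.LatticePunctured
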